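import Summits.BirchSwinnertonDyer.BirchSwinnertonDyer.Theorems.LocalTowerTorsionFiniteOfTwoStableLines
import Summits.BirchSwinnertonDyer.BirchSwinnertonDyer.Theorems.SchneiderFreeAdditiveX3LocalTowerTorsionFiniteOfLine
import Literature.NumberTheory.EllipticCurves.AnticyclotomicLocalNormResidueSymbolAnyPrimeProofs
import Literature.NumberTheory.EllipticCurves.Rank1Residual.Predicates
import HarnessLib

/-!
# `stub_finLoc_two` from the local CM structure at `2`: Fin_v on the split-bad CM class of crux 20368 is a
# THEOREM modulo ONE displayed cite-level hypothesis (the two CM eigen-lines of `E[2^∞]` with their characters)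

Cell `bsd-print-cf2`, seat `bsd-line-cf2-p1-w2` g5 (prover, width seat on crux stmt-BirchSwinnertonDyer-20368
`PrintCf2.SplitBadTwoRankOneOfFacts`; line `eisenstein_two_bdp_line` v9.1, skeleton 4c61375c77ad, lead `bsd-line-cf2-p1` g7),
registered stub **`stub_finLoc_two`**:
`… → SchneiderFreeControlAtoms.LocalTowerTorsionFiniteAt (W.baseChange K) 2 κ 𝔭` (finiteness of `E(K̄)[2^∞]^{D_𝔭 ⊓ ker κ}` — the
`2`-primary torsion of `E = W_K` up the anticyclotomic `ℤ₂`-tower completed at the chosen place above a degree-one `𝔭 ∣ 2`).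
`--supports stmt-BirchSwinnertonDyer-20368` (helper). THEOREMS ONLY (0 definitions, 0 named facts, 0 `sorry`); closes nothing by
itself; BSD is not advanced by any of this; no summit statement is proved by this seat.

WHAT. The predecessor seat (w2 g4) reduced the stub to «two stable lines, each moved with bounded kernel by an element of the local
tower group» (`WeierstrassCurve.localTowerTorsionFiniteAt_of_twoStableLines`, p627218) and supplied the moving element at `p = 2`
(`ZpExtension.exists_isFrobPow_mem_kerSubgroup_of_isAnticyclotomic_anyPrime`, p627732: the anticyclotomic norm-residue element `σ₀`
of `c(π)/π`, Frobenius degree `h`, `ε(σ₀)·φ(π)² = 2^{2h}`), leaving as residual the LOCAL CM STRUCTURE of the class at `2`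
(TURNKEY-20368-finLoc-w2g4.md, (R1)(R2)). This file TYPES that residual in the currency of cell bsd-schneider's «line with character»
(`SchneiderFreeAdditiveX3.stub_finV_gordTwo_of_lineCharacter`, here with TWO lines) and proves the stub from it:

* §1 `boundedKernel_of_smul_congr_padicInt` — the bounded-kernel clause from a GRADED scalar action: if `g` acts on each `c ∈ C` killed
  by `p^k` as any integer `N ≡ λ (mod p^k)` for a fixed `λ ∈ ℤ_p`, `λ ≠ 1`, then `p^j (g x − x) = 0 ⟹ p^{j+e} x = 0` on `C` with
  `e = v_p(λ − 1)` (generic `Γ_K`-module; complements `LocalTowerTorsionTwoLines.boundedKernel_of_smul_eq_intCast`, whose scalar is one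
  integer for the whole line).
* §2 `unitRoot_pow_ne_of_sq_eq` — for `α` in a field of characteristic `0` with `α² = aα − p`, `a² < 4p`, `2 ≤ p`: `α^n ≠ ±1` (`n ≥ 1`)
  (norm form `u² + a u v + p v² = p^n` on `α^n = u + vα`; the quotient character's value `±α^h` at `σ₀` is never `1`).
* §3 **`finLoc_two_of_cmLocalLines_at`** — ONE frame `(W, K, κ, 𝔭)`: given subgroups `C₁, C₂ ≤ E[2^∞]` (`E = W.baseChange K`) with
  `C₁ ⊓ C₂` of bounded exponent and `2^k·E[2^∞] ⊆ C₁ + C₂`, a unit `α ∈ ℤ₂` with `α² = α − 2` (the unit root of `X² − X + 2`: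
  `a₂(49a1) = 1`), and, for every `σ ∈ Γ_{K_𝔭}` of Frobenius degree `n`, stability of both lines under `res σ` and the CHARACTERS — `res σ`
  acts on `C₂[2^k]` as any integer `≡ s₂·α^{n}` and on `C₁[2^k]` as any integer `≡ s₁·ε(res σ)·α^{−n}` (`s_i = ±1`) — THEN
  `LocalTowerTorsionFiniteAt E 2 κ 𝔭`. Proof: `g = res σ₀`; on `C₂` its scalar `s₂α^h ≠ 1` by §2; on `C₁` its scalar
  `s₁ε(σ₀)α^{−h} = 1` would give `s₁α^h φ(π)² = 2^{2h}`, excluded by the weight obstruction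
  `SchneiderFreeAdditiveX3.ne_of_unitRoot_of_span_eq_pow` (`a = 1`, `p = 2`); §1 turns both into bounded kernels; p627218 concludes.
* §4 **`finLoc_two_of_cmLocalLines`** — the registered signature of `stub_finLoc_two` VERBATIM as conclusion, from the ∀-form of the
  §3 datum over the class (`W.HasCM`, `W.analyticRank = 1`, `CMSplit W 2`, `¬ Good W 2`, `K` imaginary quadratic, `𝔭 ∣ 2` of degree one):
  the text the lead can register as a cite-level stub `stub_cmLocalLinesAtTwo` with `stub_finLoc_two := finLoc_two_of_cmLocalLines stub_cmLocalLinesAtTwo`.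

WHY THE HYPOTHESIS IS TRUE (not asserted here; Deuring / Serre–Tate, cite-level). `W` in the class has `j ∈ {−3375, 16581375}`
(`CMSplit W 2 ⟺ cmFieldDiscrOfJ W.j = −7`), CM by an order of `K₀ = ℚ(√−7)` in which `2 = 𝔮𝔮̄` splits, `𝔮 = (θ)`, `θ² − θ + 2 = 0`; `W = E₀ ⊗ χ`
with `E₀` of conductor `49` (good ordinary at `2`, `a₂ = ±1`) and `χ` quadratic. `K₀ ⊂ ℚ₂ = K_𝔭`, so `D_𝔭` preserves the two eigen-lines
`C₁ = E[θ^∞]` (kernel of reduction at the chosen place, `θ ↦ 2/α`) and `C₂ = E[θ̄^∞]` (maps injectively to `Ẽ₀[2^∞] ≅ ℚ₂/ℤ₂`; for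
`j = 16581375` the lines are the saturations, of finite index and finite meet); an element of Frobenius degree `n` acts on `C₂` as the
Deuring lift `(±θ)^n` of `Frob₂^n` read `θ̄`-adically (`θ ↦ α`, the unit root) times `χ(σ)`, and on `C₁` by `ε·(that)⁻¹` (Weil pairing).
[Silverman, *Advanced Topics*, II §4 Prop. 4.4, §10 Thm. 10.5 proof, Ex. 2.30; Serre–Tate 1968 §4; Lang, *Elliptic Functions*, Ch. 13 §4 Thm. 12–13.]

References: [GreenbergLNM1716] §3 Lemma 3.3 (p. 87); [JetchevSkinnerWan2017] §3.3 Prop. 3.3.4 Case 3(b) (arXiv:1512.06894 p. 13);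
[SerreTate1968] §4; [CasselsFrohlichANT1967] Ch. VII §6; [Brink2007] §II Prop. 1.
-/

noncomputable section

open scoped Classical

namespace Summit.BirchSwinnertonDyer.BirchSwinnertonDyer.Theorems.PrintCf2.EisensteinTwo

open NumberField IsDedekindDomain Field WeierstrassCurve
  Literature.NumberTheory.EllipticCurves Literature.NumberTheory.EllipticCurves.GreenbergSelmer
  Literature.NumberTheory.EllipticCurves.Rank1Residual
  Literature.NumberTheory.GaloisRepresentations
  Summit.BirchSwinnertonDyer.Rank1Residual.X11b
  Summit.BirchSwinnertonDyer.BirchSwinnertonDyer.Theorems.SchneiderFreeAdditiveX3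
  Summit.BirchSwinnertonDyer.BirchSwinnertonDyer.Theorems.LocalTowerTorsionTwoLines
  Summit.Ventures.HodgeRepro2.T5DegreeOneNumberField

set_option linter.dupNamespace false
set_option autoImplicit false

/-! ## §1. The bounded-kernel clause from a graded scalar action by a `p`-adic integer `λ ≠ 1` -/

section Graded

variable {K : Type} [Field K] {p : ℕ} [hp : Fact p.Prime] {M : Type} [AddCommGroup M]
  [DistribMulAction (absoluteGaloisGroup K) M]

/-- **Bounded kernel from a graded scalar action.** `M` a `p`-primary `Γ_K`-module, `C ≤ M`, `g ∈ Γ_K` acting on every `c ∈ C` with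
`p^k c = 0` as ANY integer `N ≡ λ (mod p^k)`, for one `λ ∈ ℤ_p` with `λ ≠ 1`. Then `g − 1` has kernel exponent `≤ e := v_p(λ − 1)` on `C`
in the graded sense `p^j (g x − x) = 0 ⟹ p^{j+e} x = 0`: if `x` is killed by `p^k` with `k ≤ j + e` there is nothing to do; otherwise
`N − 1 ≡ λ − 1 (mod p^k)` has exact valuation `e < k`, `N − 1 = p^e u` with `p ∤ u`, and Bézout removes `u`. [folklore] -/
theorem boundedKernel_of_smul_congr_padicInt (C : AddSubgroup M) {g : absoluteGaloisGroup K}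
    {lam : ℤ_[p]} (hlam : lam ≠ 1) (htor : ∀ m : M, ∃ k : ℕ, p ^ k • m = 0)
    (hact : ∀ (k : ℕ) (c : M), c ∈ C → p ^ k • c = 0 →
      ∀ N : ℤ, ((N : ℤ_[p]) - lam) ∈ (Ideal.span {(p : ℤ_[p]) ^ k} : Ideal ℤ_[p]) → g • c = N • c) :
    ∃ e : ℕ, ∀ x ∈ C, ∀ j : ℕ, p ^ j • (g • x - x) = 0 → p ^ (j + e) • x = 0 := by
  have hpr : p.Prime := hp.out
  set t : ℤ_[p] := lam - 1 with ht
  have ht0 : t ≠ 0 := sub_ne_zero.mpr hlam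
  refine ⟨t.valuation, fun x hx j hj ↦ ?_⟩
  set e := t.valuation with he
  obtain ⟨k, hk⟩ := htor x
  -- the integer `N ≡ λ (mod p^k)` through which `g` acts on `x`
  set N : ℕ := (PadicInt.toZModPow k lam).val with hN
  have hNmem : (((N : ℤ) : ℤ_[p])) - lam ∈ (Ideal.span {(p : ℤ_[p]) ^ k} : Ideal ℤ_[p]) := by
    rw [← PadicInt.ker_toZModPow, RingHom.mem_ker, map_sub, map_intCast, Int.cast_natCast, hN,
      ZMod.natCast_zmod_val, sub_self]
  have hgx : g • x = (N : ℤ) • x := hact k x hx hk (N : ℤ) hNmem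
  by_cases hkje : k ≤ j + e
  · obtain ⟨d, hd⟩ := Nat.exists_eq_add_of_le hkje
    rw [hd, pow_add, mul_comm, mul_smul, hk, smul_zero]
  · have hek : e < k := by omega
    -- `N − 1 ≡ t (mod p^k)`, `t = p^e · unit`
    have hN1 : (((N : ℤ) - 1 : ℤ) : ℤ_[p]) = t + ((((N : ℤ) : ℤ_[p])) - lam) := by
      push_cast; rw [ht]; ring
    obtain ⟨c, hc⟩ := Ideal.mem_span_singleton.mp hNmem
    set w : ℤ_[p] := (PadicInt.unitCoeff ht0 : ℤ_[p]) with hw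
    have htu : t = w * (p : ℤ_[p]) ^ e := by rw [hw, he]; exact PadicInt.unitCoeff_spec ht0
    have hpk : (p : ℤ_[p]) ^ k = (p : ℤ_[p]) ^ e * (p : ℤ_[p]) ^ (k - e) := by
      rw [← pow_add, Nat.add_sub_cancel' hek.le]
    -- `p^e ∣ N − 1` in `ℤ`
    have hdvd : ((p : ℤ) ^ e) ∣ (N : ℤ) - 1 := by
      rw [← PadicInt.pow_p_dvd_int_iff]
      refine ⟨w + (p : ℤ_[p]) ^ (k - e) * c, ?_⟩
      rw [Int.cast_sub, Int.cast_one] at hN1 ⊢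
      rw [hN1, hc]
      linear_combination htu + c * hpk
    -- `p^{e+1} ∤ N − 1` in `ℤ`
    have hndvd : ¬ ((p : ℤ) ^ (e + 1)) ∣ (N : ℤ) - 1 := by
      rw [← PadicInt.pow_p_dvd_int_iff]
      rintro ⟨d, hd⟩
      -- then `t ∈ (p^{e+1})`, contradicting `v(t) = e`
      have htmem : t ∈ (Ideal.span {(p : ℤ_[p]) ^ (e + 1)} : Ideal ℤ_[p]) := by
        have : t = (p : ℤ_[p]) ^ (e + 1) * d - ((((N : ℤ) : ℤ_[p])) - lam) := by
          rw [Int.cast_sub, Int.cast_one] at hd hN1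
          rw [← hd, hN1]; ring
        rw [this, hc]
        refine Ideal.sub_mem _ (Ideal.mem_span_singleton.mpr ⟨d, rfl⟩) (Ideal.mem_span_singleton.mpr ⟨(p : ℤ_[p]) ^ (k - (e + 1)) * c, ?_⟩)
        rw [← mul_assoc, ← pow_add, Nat.add_sub_cancel' (by omega)]
      have := (PadicInt.mem_span_pow_iff_le_valuation t ht0 (e + 1)).mp htmem
      omega
    obtain ⟨u, hu⟩ := hdvd
    have hpu : ¬ (p : ℤ) ∣ u := by
      rintro ⟨u', rfl⟩
      exact hndvd ⟨u', by rw [hu, pow_succ]; ring⟩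
    -- `p^j (g x − x) = p^{j+e} (u • x) = 0`
    have hj' : p ^ (j + e) • (u • x) = 0 := by
      have h1 : g • x - x = ((N : ℤ) - 1) • x := by rw [hgx, sub_smul, one_smul]
      rw [h1, hu, mul_smul, show ((p : ℤ) ^ e) = ((p ^ e : ℕ) : ℤ) by push_cast; rfl, natCast_zsmul,
        smul_smul, ← pow_add] at hj
      exact hj
    exact pow_smul_eq_zero_of_pow_smul_zsmul_eq_zero hpr hpu (htor x) hj'

end Graded

/-! ## §2. A unit root of `X² − aX + p` (`a² < 4p`) is never `±1` after raising to a positive power -/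

section UnitRoot

variable {R : Type*} [Field R] [CharZero R]

/-- **`α^n ≠ ±1`** for `α` in a field of characteristic `0` with `α² = aα − p`, `a² < 4p` (no rational root), `2 ≤ p`, `n ≥ 1`.
Proof: `α^n = u_n + v_n α` with integers satisfying the norm-form identity `u_n² + a u_n v_n + p v_n² = p^n`; if `α^n = s = ±1` then
`v_n = 0` (else `α` would be rational, but `m² − a m v + p v² = 0` forces `v = 0` when `a² < 4p`), so `p^n = s² = 1`. For the class of
crux 20368: `a = 1`, `p = 2`, `α` the `2`-adic unit root of `X² − X + 2`. [folklore] -/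
theorem unitRoot_pow_ne_of_sq_eq {a p : ℤ} (hdisc : a ^ 2 < 4 * p) (hp : 2 ≤ p) {α : R} (hα : α ^ 2 = a * α - p)
    {n : ℕ} (hn : 0 < n) {s : ℤ} (hs : s = 1 ∨ s = -1) : α ^ n ≠ (s : R) := by
  -- `α^n = u + v α` with `u² + a u v + p v² = p^n`
  have key : ∀ m : ℕ, ∃ u v : ℤ, α ^ m = u + v * α ∧ u ^ 2 + a * u * v + p * v ^ 2 = p ^ m := by
    intro m
    induction m with
    | zero => exact ⟨1, 0, by simp, by simp⟩
    | succ m ih =>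
      obtain ⟨u, v, hm, hnorm⟩ := ih
      refine ⟨-p * v, u + a * v, ?_, ?_⟩
      · rw [pow_succ, hm]
        push_cast
        have : ((u : R) + v * α) * α = u * α + v * α ^ 2 := by ring
        rw [this, hα]; ring
      · have hp1 : (p : ℤ) ^ (m + 1) = p ^ m * p := pow_succ _ _
        rw [hp1, ← hnorm]; ring
  intro H
  obtain ⟨u, v, hm, hnorm⟩ := key n
  rw [hm] at H
  by_cases hv : v = 0
  · rw [hv] at H hnorm
    simp only [Int.cast_zero, zero_mul, add_zero, Int.cast_inj] at H
    rw [H] at hnorm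
    have hs2 : s ^ 2 = 1 := by rcases hs with rfl | rfl <;> norm_num
    have : (p : ℤ) ^ n = 1 := by rw [← hnorm, hs2]; ring
    have h1 : (1 : ℤ) < p ^ n := one_lt_pow₀ (by omega) hn.ne'
    omega
  · -- `α = (s − u)/v` is rational: impossible
    have hvR : (v : R) ≠ 0 := by exact_mod_cast hv
    have hαq : α = ((s : R) - u) / v := by
      rw [eq_div_iff hvR]; linear_combination H
    set m : ℤ := s - u with hmdef
    have hrel : ((m : R)) ^ 2 = a * m * v - p * v ^ 2 := by
      have h1 : (m : R) = α * v := by rw [hαq, hmdef]; push_cast; field_simp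
      have : ((m : R)) ^ 2 = α ^ 2 * v ^ 2 := by rw [h1]; ring
      rw [this, hα, h1]; ring
    have hrelZ : m ^ 2 = a * m * v - p * v ^ 2 := by exact_mod_cast hrel
    have hv2 : 0 < v ^ 2 := by positivity
    nlinarith [sq_nonneg (2 * m - a * v)]

end UnitRoot

/-! ## §3. One frame: Fin_v at `(W_K, 2, κ, 𝔭)` from the two CM lines with their characters -/

section Frame

variable {K : Type} [Field K] [NumberField K]

/-- `e(𝔭|𝓞 ℚ) = e(𝔭|ℤ)` (`ℤ → 𝓞 ℚ` is onto, so the extended ideals in `(𝓞 K)_𝔭` agree; the argument of the tree's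
`ramificationIdx_ringOfIntegers_rat_eq_int`). [folklore] -/
private theorem ramificationIdx_rat_eq_int (q : Ideal (𝓞 K)) : q.ramificationIdx (𝓞 ℚ) = q.ramificationIdx ℤ := by
  by_cases hq : q.IsPrime
  · rw [Ideal.ramificationIdx_def, Ideal.ramificationIdx_def]
    have hsurj : Function.Surjective (algebraMap ℤ (𝓞 ℚ)) := Rat.int_algebraMap_surjective (𝓞 ℚ)
    have hφ : algebraMap ℤ (Localization.AtPrime q) =
        (algebraMap (𝓞 ℚ) (Localization.AtPrime q)).comp (algebraMap ℤ (𝓞 ℚ)) := RingHom.ext_int _ _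
    have hunder : q.under ℤ = (q.under (𝓞 ℚ)).comap (algebraMap ℤ (𝓞 ℚ)) := by
      rw [Ideal.under_def, Ideal.under_def, Ideal.comap_comap, ← RingHom.ext_int
        (algebraMap ℤ (𝓞 K)) ((algebraMap (𝓞 ℚ) (𝓞 K)).comp (algebraMap ℤ (𝓞 ℚ)))]
    have hI : (q.under ℤ).map (algebraMap ℤ (Localization.AtPrime q)) =
        (q.under (𝓞 ℚ)).map (algebraMap (𝓞 ℚ) (Localization.AtPrime q)) := by
      rw [hunder, hφ, ← Ideal.map_map, Ideal.map_comap_of_surjective _ hsurj]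
    rw [hI]
  · rw [Ideal.ramificationIdx_of_not_isPrime q _ hq, Ideal.ramificationIdx_of_not_isPrime q _ hq]

/-- `f(𝔭|𝓞 ℚ) = f(𝔭|ℤ)` for a maximal ideal of a number field (tower `ℤ → 𝓞 ℚ → 𝓞 K`, `ℤ/(p) ≅ 𝓞 ℚ/(p)`; the argument of the tree's
private `inertiaDeg_ringOfIntegersRat_eq_int`). [folklore] -/
private theorem inertiaDeg_rat_eq_int (q : Ideal (𝓞 K)) [q.IsMaximal] : q.inertiaDeg (𝓞 ℚ) = q.inertiaDeg ℤ := by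
  haveI hQ : (q.under (𝓞 ℚ)).IsMaximal := Ideal.IsMaximal.under (𝓞 ℚ) q
  have h1 : (q.under (𝓞 ℚ)).inertiaDeg ℤ = 1 := by
    set Q := q.under (𝓞 ℚ)
    haveI : (Q.under ℤ).IsMaximal := Ideal.IsMaximal.under ℤ Q
    rw [← Ideal.inertiaDeg'_eq_inertiaDeg (Q.under ℤ) Q, Ideal.inertiaDeg'_algebraMap]
    letI : Field (ℤ ⧸ Q.under ℤ) := Ideal.Quotient.field _
    letI : Field (𝓞 ℚ ⧸ Q) := Ideal.Quotient.field _
    have hsurj : Function.Surjective (algebraMap (ℤ ⧸ Q.under ℤ) (𝓞 ℚ ⧸ Q)) := by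
      intro y
      obtain ⟨y, rfl⟩ := Ideal.Quotient.mk_surjective y
      obtain ⟨x, rfl⟩ := Rat.int_algebraMap_surjective (𝓞 ℚ) y
      exact ⟨Ideal.Quotient.mk _ x, rfl⟩
    have e : (ℤ ⧸ Q.under ℤ) ≃ₗ[ℤ ⧸ Q.under ℤ] (𝓞 ℚ ⧸ Q) :=
      LinearEquiv.ofBijective (Algebra.linearMap (ℤ ⧸ Q.under ℤ) (𝓞 ℚ ⧸ Q))
        ⟨(algebraMap (ℤ ⧸ Q.under ℤ) (𝓞 ℚ ⧸ Q)).injective, hsurj⟩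
    rw [← e.finrank_eq, Module.finrank_self]
  rw [Ideal.inertiaDeg_tower (R := ℤ) (q.under (𝓞 ℚ)) q, h1, one_mul]

variable (W : WeierstrassCurve ℚ) [W.IsElliptic]

/-- **Fin_v at `2` on one frame from the two CM lines with their characters.** `W/ℚ` elliptic, `K` imaginary quadratic, `κ` an
anticyclotomic `ℤ₂`-extension, `𝔭 ∋ 2` of degree one (`e = f = 1`), `E = W.baseChange K`. DATUM: `C₁, C₂ ≤ E(K̄)[2^∞]` with `C₁ ⊓ C₂`
killed by `2^f` and `2^k·E[2^∞] ⊆ C₁ + C₂`; `α ∈ ℤ₂ˣ` with `α² = α − 2`; for every `σ ∈ Γ_{K_𝔭}` of Frobenius degree `n ∈ ℕ`, `res σ`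
preserves `C₁` and `C₂` and acts on each `c ∈ C₂` killed by `2^k` as every integer `N ≡ s₂·α^n (mod 2^k)` and on each `c ∈ C₁` killed by
`2^k` as every integer `N ≡ s₁·ε(res σ)·α^{−n} (mod 2^k)`, for signs `s₁, s₂ = ±1` depending on `σ`. CONCLUSION:
`SchneiderFreeControlAtoms.LocalTowerTorsionFiniteAt E 2 κ 𝔭`. The mover is the anticyclotomic norm-residue element `σ₀` of `c(π)/π`
(`𝔭^h = (π)`; p627732): on `C₂` its scalar `s₂α^h` is not `1` (§2), on `C₁` its scalar `s₁ε(σ₀)α^{−h}` is not `1` because `ε(σ₀)φ(π)² = 2^{2h}`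
(`mul_sq_eq_of_congruences`) and `s₁α^hφ(π)² ≠ 2^{2h}` (weight, `ne_of_unitRoot_of_span_eq_pow`); §1 gives bounded kernels and
`localTowerTorsionFiniteAt_of_twoStableLines` (p627218) concludes. [cite: GreenbergLNM1716, §3 Lemma 3.3 (p. 87)]
[cite: JetchevSkinnerWan2017, §3.3 Prop. 3.3.4 Case 3(b) (arXiv:1512.06894 p. 13)] -/
theorem finLoc_two_of_cmLocalLines_at (hK : IsImaginaryQuadratic K) (κ : ZpExtension K 2) (hκ : κ.IsAnticyclotomic)
    (𝔭 : HeightOneSpectrum (𝓞 K)) (h𝔭 : ((2 : ℕ) : 𝓞 K) ∈ 𝔭.asIdeal) (he : 𝔭.asIdeal.ramificationIdx (𝓞 ℚ) = 1)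
    (hf : 𝔭.asIdeal.inertiaDeg (𝓞 ℚ) = 1)
    (C₁ C₂ : AddSubgroup ((W.baseChange K).geomPrimaryTorsion 2)) (α : ℤ_[2]ˣ) (hα : (α : ℤ_[2]) ^ 2 = (α : ℤ_[2]) - 2)
    (hmeet : ∃ f : ℕ, ∀ x ∈ C₁, x ∈ C₂ → 2 ^ f • x = 0)
    (hsum : ∃ k : ℕ, ∀ m : (W.baseChange K).geomPrimaryTorsion 2, 2 ^ k • m ∈ C₁ ⊔ C₂)
    (hchar : ∀ (σ : absoluteGaloisGroup (𝔭.adicCompletion K)) (n : ℕ), IsFrobPow σ (n : ℤ) →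
      (∀ c ∈ C₁, absGaloisRestrict K (𝔭.adicCompletion K) σ • c ∈ C₁) ∧
      (∀ c ∈ C₂, absGaloisRestrict K (𝔭.adicCompletion K) σ • c ∈ C₂) ∧
      ∃ s₁ s₂ : ℤ, (s₁ = 1 ∨ s₁ = -1) ∧ (s₂ = 1 ∨ s₂ = -1) ∧
        (∀ (k : ℕ) (c : (W.baseChange K).geomPrimaryTorsion 2), c ∈ C₁ → 2 ^ k • c = 0 →
          ∀ N : ℤ, ((N : ℤ_[2]) - s₁ *
              ((GaloisRep.cyclotomicCharacter K 2 (absGaloisRestrict K (𝔭.adicCompletion K) σ) * (α⁻¹) ^ n : ℤ_[2]ˣ) :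
                ℤ_[2])) ∈ (Ideal.span {(2 : ℤ_[2]) ^ k} : Ideal ℤ_[2]) →
            absGaloisRestrict K (𝔭.adicCompletion K) σ • c = N • c) ∧
        (∀ (k : ℕ) (c : (W.baseChange K).geomPrimaryTorsion 2), c ∈ C₂ → 2 ^ k • c = 0 →
          ∀ N : ℤ, ((N : ℤ_[2]) - s₂ * ((α ^ n : ℤ_[2]ˣ) : ℤ_[2])) ∈ (Ideal.span {(2 : ℤ_[2]) ^ k} : Ideal ℤ_[2]) →
            absGaloisRestrict K (𝔭.adicCompletion K) σ • c = N • c)) :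
    SchneiderFreeControlAtoms.LocalTowerTorsionFiniteAt (W.baseChange K) 2 κ 𝔭 := by
  haveI : (W.baseChange K).IsElliptic := by rw [baseChange]; infer_instance
  have hpr : (2 : ℕ).Prime := Nat.prime_two
  have h2 : Module.finrank ℚ K = 2 := hK.1
  haveI := liesOver_span_of_natCast_mem (K := K) (p := 2) h𝔭
  haveI := 𝔭.isMaximal
  have hdeg : 𝔭.asIdeal.ramificationIdx ℤ * 𝔭.asIdeal.inertiaDeg ℤ = 1 := by
    rw [← ramificationIdx_rat_eq_int, ← inertiaDeg_rat_eq_int, he, hf]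
  obtain ⟨h, π, hh, hπ⟩ := exists_pow_eq_span_singleton 𝔭
  obtain ⟨σ₀, hfrob, hker, hcyc⟩ :=
    ZpExtension.exists_isFrobPow_mem_kerSubgroup_of_isAnticyclotomic_anyPrime K 2 hK 𝔭 h𝔭 he hf h π hh hπ
  set g := absGaloisRestrict K (𝔭.adicCompletion K) σ₀ with hg
  have hgN : g ∈ decomp 𝔭 ⊓ κ.kerSubgroup := Subgroup.mem_inf.mpr ⟨⟨σ₀, rfl⟩, hker κ hκ⟩
  obtain ⟨hst₁, hst₂, s₁, s₂, hs₁, hs₂, hact₁, hact₂⟩ := hchar σ₀ h hfrob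
  set εu : ℤ_[2]ˣ := GaloisRep.cyclotomicCharacter K 2 g with hεu
  -- Step A: `ε(σ₀) φ(π)² = 2^{2h}`
  have hB := mul_sq_eq_of_congruences (p := 2) 𝔭 hdeg hπ hcyc
  set φ := integersToPadicInt 𝔭 2 hdeg with hφ
  -- the module is `2`-primary
  have htor : ∀ m : (W.baseChange K).geomPrimaryTorsion 2, ∃ k : ℕ, 2 ^ k • m = 0 := fun x ↦ by
    obtain ⟨k, hk⟩ := x.2
    exact ⟨k, Subtype.ext (by rw [AddSubgroupClass.coe_nsmul, hk]; rfl)⟩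
  -- `α² = α − 2` read in `ℚ₂`
  have hαQ : (((α : ℤ_[2]) : ℚ_[2])) ^ 2 = ((α : ℤ_[2]) : ℚ_[2]) - 2 := by
    have := congrArg (fun z : ℤ_[2] ↦ (z : ℚ_[2])) hα
    push_cast at this
    exact this
  -- Step B: the scalar on `C₂` is not `1`
  have hlam₂ : (s₂ : ℤ_[2]) * ((α ^ h : ℤ_[2]ˣ) : ℤ_[2]) ≠ 1 := by
    intro H
    have hss : (s₂ : ℤ_[2]) * s₂ = 1 := by rcases hs₂ with rfl | rfl <;> push_cast <;> norm_num
    have H' : ((α : ℤ_[2])) ^ h = s₂ := by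
      calc ((α : ℤ_[2])) ^ h = (s₂ : ℤ_[2]) * s₂ * (α : ℤ_[2]) ^ h := by rw [hss, one_mul]
        _ = s₂ * ((s₂ : ℤ_[2]) * ((α ^ h : ℤ_[2]ˣ) : ℤ_[2])) := by rw [Units.val_pow_eq_pow_val]; ring
        _ = s₂ := by rw [H, mul_one]
    have H'' : (((α : ℤ_[2]) : ℚ_[2])) ^ h = (s₂ : ℚ_[2]) := by
      have := congrArg (fun z : ℤ_[2] ↦ (z : ℚ_[2])) H'
      simpa using this
    exact unitRoot_pow_ne_of_sq_eq (R := ℚ_[2]) (a := 1) (p := 2) (by norm_num) le_rfl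
      (α := ((α : ℤ_[2]) : ℚ_[2])) (by push_cast; linear_combination hαQ) hh hs₂ H''
  -- Step C: the scalar on `C₁` is not `1` (weight obstruction)
  have hlam₁ : (s₁ : ℤ_[2]) * ((εu * (α⁻¹) ^ h : ℤ_[2]ˣ) : ℤ_[2]) ≠ 1 := by
    intro H
    have hss : (s₁ : ℤ_[2]) * s₁ = 1 := by rcases hs₁ with rfl | rfl <;> push_cast <;> norm_num
    have hεα : (εu : ℤ_[2]) = s₁ * (α : ℤ_[2]) ^ h := by
      have h2' : ((α⁻¹ ^ h : ℤ_[2]ˣ) : ℤ_[2]) * (α : ℤ_[2]) ^ h = 1 := by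
        rw [← Units.val_pow_eq_pow_val, ← Units.val_mul, ← mul_pow, inv_mul_cancel, one_pow, Units.val_one]
      calc (εu : ℤ_[2]) = (s₁ * s₁) * (εu : ℤ_[2]) * (((α⁻¹ ^ h : ℤ_[2]ˣ) : ℤ_[2]) * (α : ℤ_[2]) ^ h) := by
              rw [hss, h2', one_mul, mul_one]
        _ = s₁ * ((s₁ : ℤ_[2]) * ((εu * (α⁻¹) ^ h : ℤ_[2]ˣ) : ℤ_[2])) * (α : ℤ_[2]) ^ h := by
              rw [Units.val_mul]; ring
        _ = s₁ * (α : ℤ_[2]) ^ h := by rw [H, mul_one]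
    have hC : (s₁ : ℤ_[2]) * (α : ℤ_[2]) ^ h * φ π ^ 2 = ((2 : ℕ) : ℤ_[2]) ^ (2 * h) := by
      rw [← hεα]; exact hB
    have hN : Ideal.absNorm 𝔭.asIdeal = 2 := by
      rw [Ideal.absNorm_apply, Submodule.cardQuot_apply, ← pow_one 𝔭.asIdeal, natCard_quot_pow' 𝔭 2 hdeg 1, pow_one]
    have hφ' : Function.Injective ((PadicInt.Coe.ringHom (p := 2)).comp φ) :=
      (Subtype.val_injective).comp (integersToPadicInt_injective 𝔭 2 hdeg)
    refine ne_of_unitRoot_of_span_eq_pow (R := ℚ_[2]) h2 𝔭.isPrime hpr hN h𝔭 (natCast_notMem_sq 𝔭 2 hdeg) hh hπ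
      ((PadicInt.Coe.ringHom (p := 2)).comp φ) hφ' (a := 1) (α := ((α : ℤ_[2]) : ℚ_[2]))
      (by push_cast; linear_combination hαQ) hs₁ ?_
    have := congrArg (fun z : ℤ_[2] ↦ (z : ℚ_[2])) hC
    push_cast at this
    exact this
  -- Step D: bounded kernels on both lines, then the two-lines principle
  obtain ⟨e₁, he₁⟩ := boundedKernel_of_smul_congr_padicInt (K := K) C₁ (g := g) hlam₁ htor
    (fun k c hc hk N hN ↦ hact₁ k c hc hk N hN)
  obtain ⟨e₂, he₂⟩ := boundedKernel_of_smul_congr_padicInt (K := K) C₂ (g := g) hlam₂ htor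
    (fun k c hc hk N hN ↦ hact₂ k c hc hk N hN)
  exact (W.baseChange K).localTowerTorsionFiniteAt_of_twoStableLines κ 𝔭 C₁ C₂ hmeet hsum
    ⟨g, hgN, hst₁, hst₂, e₁, he₁⟩ ⟨g, hgN, hst₁, hst₂, e₂, he₂⟩

end Frame

/-! ## §4. The registered stub `stub_finLoc_two` from the ∀-form of the local CM datum over the class -/

/-- **`stub_finLoc_two` modulo the local CM structure at `2`** — the registered signature of the stub (crux 20368, line
`eisenstein_two_bdp_line` v9.1) VERBATIM as conclusion, from ONE displayed hypothesis `hLines`: for every `W` in the class (`W.HasCM`,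
`W.analyticRank = 1`, `CMSplit W 2`, `¬ Good W 2`), every imaginary quadratic `K` and every degree-one `𝔭 ∣ 2` of `K`, the two-lines datum of
`finLoc_two_of_cmLocalLines_at` for `E = W.baseChange K` at `𝔭` (two subgroups of `E[2^∞]` with bounded meet and cofinite sum, the unit
root `α` of `X² − X + 2`, and the characters `s₂·α^n` / `s₁·ε·α^{−n}` of the elements of Frobenius degree `n`). `hLines` is the
Deuring / Serre–Tate local structure of the class (cite-level; see the module docstring) — the text a lead can register as
`stub_cmLocalLinesAtTwo`, with `stub_finLoc_two := finLoc_two_of_cmLocalLines stub_cmLocalLinesAtTwo`. CONDITIONAL on `hLines`;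
closes nothing by itself. [cite: GreenbergLNM1716, §3 Lemma 3.3 (p. 87)] [cite: SerreTate1968, §4 Thm. 6 (local components of the CM character)] -/
theorem finLoc_two_of_cmLocalLines
    (hLines : ∀ (W : WeierstrassCurve ℚ) [W.IsElliptic] [W.IsGloballyMinimal],
      W.HasCM → W.analyticRank = 1 → CMSplit W 2 → ¬ Good W 2 →
      ∀ (K : Type) [Field K] [NumberField K], IsImaginaryQuadratic K →
        ∀ (𝔭 : HeightOneSpectrum (𝓞 K)), ((2 : ℕ) : 𝓞 K) ∈ 𝔭.asIdeal → 𝔭.asIdeal.ramificationIdx (𝓞 ℚ) = 1 →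
          𝔭.asIdeal.inertiaDeg (𝓞 ℚ) = 1 →
          ∃ (C₁ C₂ : AddSubgroup ((W.baseChange K).geomPrimaryTorsion 2)) (α : ℤ_[2]ˣ),
            (α : ℤ_[2]) ^ 2 = (α : ℤ_[2]) - 2 ∧
            (∃ f : ℕ, ∀ x ∈ C₁, x ∈ C₂ → 2 ^ f • x = 0) ∧
            (∃ k : ℕ, ∀ m : (W.baseChange K).geomPrimaryTorsion 2, 2 ^ k • m ∈ C₁ ⊔ C₂) ∧
            ∀ (σ : absoluteGaloisGroup (𝔭.adicCompletion K)) (n : ℕ), IsFrobPow σ (n : ℤ) →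
              (∀ c ∈ C₁, absGaloisRestrict K (𝔭.adicCompletion K) σ • c ∈ C₁) ∧
              (∀ c ∈ C₂, absGaloisRestrict K (𝔭.adicCompletion K) σ • c ∈ C₂) ∧
              ∃ s₁ s₂ : ℤ, (s₁ = 1 ∨ s₁ = -1) ∧ (s₂ = 1 ∨ s₂ = -1) ∧
                (∀ (k : ℕ) (c : (W.baseChange K).geomPrimaryTorsion 2), c ∈ C₁ → 2 ^ k • c = 0 →
                  ∀ N : ℤ, ((N : ℤ_[2]) - s₁ *
                      ((GaloisRep.cyclotomicCharacter K 2 (absGaloisRestrict K (𝔭.adicCompletion K) σ) * (α⁻¹) ^ n :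
                        ℤ_[2]ˣ) : ℤ_[2])) ∈ (Ideal.span {(2 : ℤ_[2]) ^ k} : Ideal ℤ_[2]) →
                    absGaloisRestrict K (𝔭.adicCompletion K) σ • c = N • c) ∧
                (∀ (k : ℕ) (c : (W.baseChange K).geomPrimaryTorsion 2), c ∈ C₂ → 2 ^ k • c = 0 →
                  ∀ N : ℤ, ((N : ℤ_[2]) - s₂ * ((α ^ n : ℤ_[2]ˣ) : ℤ_[2])) ∈
                      (Ideal.span {(2 : ℤ_[2]) ^ k} : Ideal ℤ_[2]) →
                    absGaloisRestrict K (𝔭.adicCompletion K) σ • c = N • c)) :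
    ∀ (W : WeierstrassCurve ℚ) [W.IsElliptic] [W.IsGloballyMinimal],
      W.HasCM → W.analyticRank = 1 → CMSplit W 2 → ¬ Good W 2 →
      ∀ (K : Type) [Field K] [NumberField K], IsImaginaryQuadratic K →
        ∀ (κ : ZpExtension K 2), κ.IsAnticyclotomic →
          ∀ (𝔭 : HeightOneSpectrum (𝓞 K)), ((2 : ℕ) : 𝓞 K) ∈ 𝔭.asIdeal → 𝔭.asIdeal.ramificationIdx (𝓞 ℚ) = 1 →
            𝔭.asIdeal.inertiaDeg (𝓞 ℚ) = 1 →
            SchneiderFreeControlAtoms.LocalTowerTorsionFiniteAt (W.baseChange K) 2 κ 𝔭 := by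
  intro W _ _ hCM hr hsp hng K _ _ hK κ hκ 𝔭 h𝔭 he hf
  obtain ⟨C₁, C₂, α, hα, hmeet, hsum, hchar⟩ := hLines W hCM hr hsp hng K hK 𝔭 h𝔭 he hf
  exact finLoc_two_of_cmLocalLines_at W hK κ hκ 𝔭 h𝔭 he hf C₁ C₂ α hα hmeet hsum hchar

end Summit.BirchSwinnertonDyer.BirchSwinnertonDyer.Theorems.PrintCf2.EisensteinTwo

end
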